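import Summits.Ventures.LatticeQCDFlow.Scaling.DominatedStarRegimeFreeRelaxation

/-!
HONEST FRAMING: exact (Metropolis-corrected) sampling algorithms for lattice gauge theory; figures
of merit are autocorrelation/cost numbers at stated couplings and volumes; no continuum-physics
claim.

# DominatedStarRegimeFreeCost — COST ACCOUNTING WITHOUT THE REGIME: IF A SWAP ATTEMPT (TRANSPORT + ACCEPTANCE TEST) COSTS `κ_s`
# AND AN UPDATE `κ_u`, ONE RELAXATION TIME OF THE MAP-ASSISTED HOT-REFRESHED HUB COSTS AT MOST
# `(tκ_s + (1−t)κ_u)/(p·min{ct/(3m), (1−t)w_0/(7K)})` AND ONE AUTOCORRELATION TIME OF ANY OBSERVABLE AT MOST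
# `(1/(p·min{…}) − ½)·(tκ_s + (1−t)κ_u)`; AT `t = 1/2`, `w_0 = 1`, `m ≤ cK`: **AT MOST `7K(κ_s + κ_u)/p`** — ORDER `K/p` SWAP TESTS
# AND ORDER `K/p` EXACT HOT DRAWS, WHERE THE TUNED REGIME OF CHAPTER M PAID `2Kκ_s/p + 8Kκ_u/p²` (lean-2 GEN-28, ours)

Venture-side (OURS).  Cell `lqcd-flow` (pub-lqcd), unit `pub-lqcd-lean-2-g28`, 2026-08-28.  Chapter N, file 5: chapter N in the
currency of `Scaling/ExchangeCostLaw` (chapter K) and `Scaling/DominatedStarCostCeiling` (M19).  The mean cost of a step of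
`P = t·GSw + (1−t)·Π_w^M` is `tκ_s + (1−t)κ_u`; the cost of a relaxation time is that times `t_rel`, the cost of an independent-
equivalent sample of `g` is that times `2τ_int(g)`.  M19, inside the regime `4t ≤ p(1−t)w_0`, had to run at `t = p/(4+p)` and paid
the hot draws quadratically in `1/p` ("NOT CLAIMED: that the `1/p²` is necessary").  With the regime-free relaxation time of
`Scaling/DominatedStarRegimeFreeRelaxation` (N4) and the `τ_int` ceiling of `Scaling/DominatedStarRegimeFreeAutocorrelation` (N3) the
swap fraction is free, and at `t = 1/2` both prices are linear in `1/p`.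

## What is proved

* **`dominatedStar_relaxationCost_le_regimeFree`** — `(tκ_s + (1−t)κ_u)·t_rel ≤ (tκ_s + (1−t)κ_u)/(p·min{ct/(3m), (1−t)w_0/(7K)})`.
* **`dominatedStar_autocorrelationCost_le_regimeFree`** (`|S| ≥ 2`, `Var(g) > 0`) —
  `τ_int(g)·(tκ_s + (1−t)κ_u) ≤ (1/(p·min{ct/(3m), (1−t)w_0/(7K)}) − ½)·(tκ_s + (1−t)κ_u)`.
* **`halfStar_autocorrelationCost_le`** — `t = 1/2`, `w_0 = 1`, `m ≤ cK`: **`τ_int(g)·((κ_s + κ_u)/2) ≤ 7K(κ_s + κ_u)/p`**;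
  **`halfStar_relaxationCost_le`** — `((κ_s + κ_u)/2)·t_rel ≤ 7K(κ_s + κ_u)/p`.

Reading (no numerics implied): per effectively independent sample of ANY observable, the exact (Metropolis-corrected) tempering hub
with a learned transport of one-sided quality `p` needs at most order `K/p` transport evaluations-with-test AND order `K/p` exact hot
draws at uniform listing and half swaps — the `1/p²` of M19 was the price of the regime, not of the sampler; against chapter K's floor
of order `K` swaps plus `K/γ₀` hot updates per relaxation (`Scaling/ExchangeCostLaw`).  NOT CLAIMED: amortised training costs (a
constant added to `κ_s` per use under a stated schedule only); parallel execution; the same accounting for the mixing time with a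
`log K` (item 1); anything measured.  Literature grade (cell rule): OWN COMPOSITION (N3/N4 + arithmetic); nothing cited as a fact;
no new bib keys.
-/

noncomputable section

open Finset Function
open Literature.Probability.MarkovChains

namespace Summit.Ventures.LatticeQCDFlow.Scaling

variable {S : Type*} [Fintype S] [DecidableEq S] {K m : ℕ} {μ : Fin (K + 1) → S → ℝ} {M : Fin (K + 1) → S → S → ℝ}
  {w : Fin (K + 1) → ℝ} {t p : ℝ}

section Cost
variable (κ : Fin m → Fin K) (φ : Fin m → Equiv.Perm S)

/-- **THE COST OF ONE RELAXATION TIME, NO REGIME:** `(tκ_s + (1−t)κ_u)·t_rel ≤ (tκ_s + (1−t)κ_u)/(p·min{ct/(3m), (1−t)w_0/(7K)})`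
(exact hot sampler, one-sided domination, reversible cold kernels, multiplicities `≥ c ≥ 1`, `0 < t < 1`, `w_0 > 0`, `κ_s, κ_u ≥ 0`,
`|S| ≥ 2`, `K ≥ 1`). [ours] -/
theorem dominatedStar_relaxationCost_le_regimeFree [Nontrivial S] (hK : 1 ≤ K) (hm : 1 ≤ m) (ht0 : 0 < t) (ht1 : t < 1)
    (hw0 : ∀ k, 0 ≤ w k) (hw00 : 0 < w 0) (hw1 : ∑ k, w k = 1) (hμ : ∀ k x, 0 < μ k x)
    (hμ1 : ∀ k, ∑ u, μ k u = 1) (hM : ∀ k, IsRowStochastic (M k)) (hMrev : ∀ k, DetailedBalance (μ k) (M k))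
    (hM0 : ∀ u v, M 0 u v = μ 0 v) (hp0 : 0 < p) (hp1 : p ≤ 1) (hdom : ∀ r u, p * μ (κ r).succ (φ r u) ≤ μ 0 u)
    {c : ℕ} (hc1 : 1 ≤ c) (hc : ∀ p' : Fin K, c ≤ (univ.filter (fun r : Fin m => κ r = p')).card)
    {κs κu : ℝ} (hκs : 0 ≤ κs) (hκu : 0 ≤ κu) :
    (t * κs + (1 - t) * κu) * relaxationTime (fun y z : Fin (K + 1) → S =>
        t * ptGraphSwap μ (fun r : Fin m => (((0 : Fin (K + 1)), (κ r).succ) : Fin (K + 1) × Fin (K + 1))) φ y z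
          + (1 - t) * prodKernel w M y z)
      ≤ (t * κs + (1 - t) * κu) / (p * min (c * t / (3 * m)) ((1 - t) * w 0 / (7 * K))) := by
  have hrel := dominatedStar_relaxationTime_le_regimeFree κ φ hK hm ht0 ht1 hw0 hw00 hw1 hμ hμ1 hM hMrev hM0 hp0 hp1 hdom hc1 hc
  have hcost : 0 ≤ t * κs + (1 - t) * κu := by nlinarith
  calc (t * κs + (1 - t) * κu) * relaxationTime _
      ≤ (t * κs + (1 - t) * κu) * (1 / (p * min (c * t / (3 * m)) ((1 - t) * w 0 / (7 * K)))) :=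
        mul_le_mul_of_nonneg_left hrel hcost
    _ = _ := by rw [mul_one_div]

/-- **THE COST OF ONE AUTOCORRELATION TIME OF ANY OBSERVABLE, NO REGIME:**
`τ_int(g)·(tκ_s + (1−t)κ_u) ≤ (1/(p·min{ct/(3m), (1−t)w_0/(7K)}) − ½)·(tκ_s + (1−t)κ_u)` (`Var(g) > 0`). [ours] -/
theorem dominatedStar_autocorrelationCost_le_regimeFree [Nontrivial S] (hK : 1 ≤ K) (hm : 1 ≤ m) (ht0 : 0 < t) (ht1 : t < 1)
    (hw0 : ∀ k, 0 ≤ w k) (hw00 : 0 < w 0) (hw1 : ∑ k, w k = 1) (hμ : ∀ k x, 0 < μ k x)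
    (hμ1 : ∀ k, ∑ u, μ k u = 1) (hM : ∀ k, IsRowStochastic (M k)) (hMrev : ∀ k, DetailedBalance (μ k) (M k))
    (hM0 : ∀ u v, M 0 u v = μ 0 v) (hp0 : 0 < p) (hp1 : p ≤ 1) (hdom : ∀ r u, p * μ (κ r).succ (φ r u) ≤ μ 0 u)
    {c : ℕ} (hc1 : 1 ≤ c) (hc : ∀ p' : Fin K, c ≤ (univ.filter (fun r : Fin m => κ r = p')).card)
    {κs κu : ℝ} (hκs : 0 ≤ κs) (hκu : 0 ≤ κu) {g : (Fin (K + 1) → S) → ℝ} (hg : 0 < lawVariance (tensorFun μ) g) :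
    asympVar g (tensorFun μ) (fun y z : Fin (K + 1) → S =>
        t * ptGraphSwap μ (fun r : Fin m => (((0 : Fin (K + 1)), (κ r).succ) : Fin (K + 1) × Fin (K + 1))) φ y z
          + (1 - t) * prodKernel w M y z) / (2 * lawVariance (tensorFun μ) g) * (t * κs + (1 - t) * κu)
      ≤ (1 / (p * min (c * t / (3 * m)) ((1 - t) * w 0 / (7 * K))) - 1 / 2) * (t * κs + (1 - t) * κu) := by
  have hcost : 0 ≤ t * κs + (1 - t) * κu := by nlinarith
  exact mul_le_mul_of_nonneg_right (dominatedStar_tauInt_le_regimeFree κ φ hK hm ht0 ht1 hw0 hw00 hw1 hμ hμ1 hM hMrev hM0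
    hp0 hp1 hdom hc1 hc hg) hcost

/-- **HALF SWAPS, HOT-ONLY REFRESH WEIGHT, UNIFORM LISTING: `τ_int(g)·((κ_s + κ_u)/2) ≤ 7K(κ_s + κ_u)/p`** for every observable
(`t = 1/2`, `w_0 = 1`, `m ≤ cK`; exact hot sampler, one-sided transports of quality `p`, reversible cold kernels, `Var(g) > 0`,
`|S| ≥ 2`, `K ≥ 1`) — order `K/p` swap tests AND order `K/p` exact hot draws per effectively independent sample; M19's tuned regime
paid `2Kκ_s/p + 8Kκ_u/p²`. [ours] -/
theorem halfStar_autocorrelationCost_le [Nontrivial S] (hK : 1 ≤ K) (hm : 1 ≤ m) (hw0 : ∀ k, 0 ≤ w k) (hw01 : w 0 = 1)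
    (hw1 : ∑ k, w k = 1) (hμ : ∀ k x, 0 < μ k x) (hμ1 : ∀ k, ∑ u, μ k u = 1) (hM : ∀ k, IsRowStochastic (M k))
    (hMrev : ∀ k, DetailedBalance (μ k) (M k)) (hM0 : ∀ u v, M 0 u v = μ 0 v) (hp0 : 0 < p) (hp1 : p ≤ 1)
    (hdom : ∀ r u, p * μ (κ r).succ (φ r u) ≤ μ 0 u)
    {c : ℕ} (hc1 : 1 ≤ c) (hc : ∀ p' : Fin K, c ≤ (univ.filter (fun r : Fin m => κ r = p')).card)
    (hmcK : (m : ℝ) ≤ c * K) {κs κu : ℝ} (hκs : 0 ≤ κs) (hκu : 0 ≤ κu)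
    {g : (Fin (K + 1) → S) → ℝ} (hg : 0 < lawVariance (tensorFun μ) g) :
    asympVar g (tensorFun μ) (fun y z : Fin (K + 1) → S =>
        (1 / 2 : ℝ) * ptGraphSwap μ (fun r : Fin m => (((0 : Fin (K + 1)), (κ r).succ) : Fin (K + 1) × Fin (K + 1))) φ y z
          + (1 - 1 / 2) * prodKernel w M y z) / (2 * lawVariance (tensorFun μ) g) * ((κs + κu) / 2)
      ≤ 7 * K * (κs + κu) / p := by
  have hKpos : (0 : ℝ) < K := Nat.cast_pos.mpr (by omega)
  have hτ := uniformStar_tauInt_le_half κ φ hK hm hw0 hw01 hw1 hμ hμ1 hM hMrev hM0 hp0 hp1 hdom hc1 hc hmcK hg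
  have hcost : 0 ≤ (κs + κu) / 2 := by positivity
  have h := mul_le_mul_of_nonneg_right hτ hcost
  refine h.trans ?_
  -- `(14K/p − ½)·(κ_s + κ_u)/2 ≤ (14K/p)·(κ_s + κ_u)/2 = 7K(κ_s + κ_u)/p`
  have e : 14 * (K : ℝ) / p * ((κs + κu) / 2) = 7 * K * (κs + κu) / p := by
    field_simp
    ring
  have hsum : 0 ≤ κs + κu := by positivity
  nlinarith [e]

/-- **HALF SWAPS: ONE RELAXATION TIME COSTS AT MOST `7K(κ_s + κ_u)/p`** (`t = 1/2`, `w_0 = 1`, `m ≤ cK`; same hypotheses). [ours] -/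
theorem halfStar_relaxationCost_le [Nontrivial S] (hK : 1 ≤ K) (hm : 1 ≤ m) (hw0 : ∀ k, 0 ≤ w k) (hw01 : w 0 = 1)
    (hw1 : ∑ k, w k = 1) (hμ : ∀ k x, 0 < μ k x) (hμ1 : ∀ k, ∑ u, μ k u = 1) (hM : ∀ k, IsRowStochastic (M k))
    (hMrev : ∀ k, DetailedBalance (μ k) (M k)) (hM0 : ∀ u v, M 0 u v = μ 0 v) (hp0 : 0 < p) (hp1 : p ≤ 1)
    (hdom : ∀ r u, p * μ (κ r).succ (φ r u) ≤ μ 0 u)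
    {c : ℕ} (hc1 : 1 ≤ c) (hc : ∀ p' : Fin K, c ≤ (univ.filter (fun r : Fin m => κ r = p')).card)
    (hmcK : (m : ℝ) ≤ c * K) {κs κu : ℝ} (hκs : 0 ≤ κs) (hκu : 0 ≤ κu) :
    ((κs + κu) / 2) * relaxationTime (fun y z : Fin (K + 1) → S =>
        (1 / 2 : ℝ) * ptGraphSwap μ (fun r : Fin m => (((0 : Fin (K + 1)), (κ r).succ) : Fin (K + 1) × Fin (K + 1))) φ y z
          + (1 - 1 / 2) * prodKernel w M y z)
      ≤ 7 * K * (κs + κu) / p := by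
  have hKpos : (0 : ℝ) < K := Nat.cast_pos.mpr (by omega)
  have hmpos : (0 : ℝ) < m := Nat.cast_pos.mpr (by omega)
  have hcpos : (0 : ℝ) < c := Nat.cast_pos.mpr (by omega)
  have hrel := dominatedStar_relaxationTime_le_regimeFree κ φ hK hm (t := 1 / 2) (by norm_num) (by norm_num) hw0
    (by rw [hw01]; exact one_pos) hw1 hμ hμ1 hM hMrev hM0 hp0 hp1 hdom hc1 hc
  rw [hw01] at hrel
  -- the floor at `t = 1/2`, `w_0 = 1` is at least `p/(14K)` when `m ≤ cK`
  have hmin : 1 / (14 * (K : ℝ)) ≤ min (c * (1 / 2) / (3 * (m : ℝ))) ((1 - 1 / 2) * 1 / (7 * K)) := by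
    refine le_min ?_ (le_of_eq (by ring))
    rw [div_le_div_iff₀ (by positivity) (by positivity)]
    nlinarith
  have hpos : 0 < p * (1 / (14 * (K : ℝ))) := by positivity
  have hle : 1 / (p * min (c * (1 / 2) / (3 * (m : ℝ))) ((1 - 1 / 2) * 1 / (7 * K))) ≤ 1 / (p * (1 / (14 * K))) :=
    one_div_le_one_div_of_le hpos (mul_le_mul_of_nonneg_left hmin hp0.le)
  have e : 1 / (p * (1 / (14 * (K : ℝ)))) = 14 * K / p := by
    field_simp
  have hcost : 0 ≤ (κs + κu) / 2 := by positivity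
  have hrel' := hrel.trans (hle.trans e.le)
  calc (κs + κu) / 2 * relaxationTime _ ≤ (κs + κu) / 2 * (14 * K / p) := mul_le_mul_of_nonneg_left hrel' hcost
    _ = 7 * K * (κs + κu) / p := by
        field_simp
        ring

end Cost

end Summit.Ventures.LatticeQCDFlow.Scaling

end
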